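import Mathlib
import HarnessLib
import Summits.MatrixMultiplication.MatrixMultiplication.Theorems.OutsiderSandwichToricCeilingPowMixedGlue
import Summits.MatrixMultiplication.MatrixMultiplication.Theorems.OutsiderSandwichToricCeilingPowMixedRules

/-!
# OutsiderSandwich — toric ceiling of `cw₂^{⊠N}`: TRANSPORT of perfect matchings under the
symmetries of a product frame
(decomp-mm lens 4, gen 47, kernel K47-5; THESES-FREE, `ω`-free; helper toward `LaserTangency`,
stmt-32268 — the extremal subrank/packing cells of the literal host `kroneckerPow (cwTensor ℂ 2) N`)

LABEL.  TORIC · uniform in `N` · NEC-side instrument (symmetry lemmas used by the `N = 3` two-cw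
base census `…PowTwoCwBase`); the rates, the crux `h₁ = LaserTangency` and the route's `closes`
are untouched.

WHAT.  `isPMκ_transport`: a word bijection `φ : Word m ≃ Word m` mapping the product frame
`frame κ` into `frame κ'` carries a perfect matching of `frame κ` minus `(X, Y, Z)`
(`…PowMixedGlue.isPMκ`) to one of `frame κ'` minus `(φX, φY, φZ)`.  Instances: `permW σ`
(permuting COORDINATES, `frame κ → frame (κ ∘ σ)`), `relabW τ` (relabelling LETTERS coordinatewise
by slot-preserving bijections, `frame κ → frame κ`), and the leg swap `isPMκ_swapYZ`
(`(X, Y, Z) ↦ (X, Z, Y)`; every product frame is invariant under exchanging the `B`- and `C`-legs,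
`slotB_swap23`), with the corresponding invariance of the two-basis letter law `lawκ`
(`lawκ_swap_yz`).  Existence-level wrappers `exists_isPMκ_transport`, `exists_isPMκ_perm_symm`.
No new axioms; definitions: `map3`, `permW`, `relabW`, `swapYZ` (plain data).
-/

set_option linter.dupNamespace false

namespace Summit.MatrixMultiplication.MatrixMultiplication.Theorems.OutsiderSandwichToricCeilingPowTransport

open Finset
open Summit.MatrixMultiplication.MatrixMultiplication.Theorems.OutsiderSandwichToricCeilingPowFibres
  (Word Tr3 slotB frame)
open Summit.MatrixMultiplication.MatrixMultiplication.Theorems.OutsiderSandwichToricCeilingPowMixedGlue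
open Summit.MatrixMultiplication.MatrixMultiplication.Theorems.OutsiderSandwichToricCeilingPowMixedRules

variable {m : ℕ}

/-! ## §1 The transport lemma -/

/-- Apply a word map to the three legs of a triple. [new] -/
def map3 (φ : Word m → Word m) (t : Tr3 m) : Tr3 m := (φ t.1, φ t.2.1, φ t.2.2)

/-- First leg of a mapped triple. -/
@[simp] theorem map3_fst (φ : Word m → Word m) (t : Tr3 m) : (map3 φ t).1 = φ t.1 := rfl
/-- Second leg of a mapped triple. -/
@[simp] theorem map3_snd_fst (φ : Word m → Word m) (t : Tr3 m) : (map3 φ t).2.1 = φ t.2.1 := rfl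
/-- Third leg of a mapped triple. -/
@[simp] theorem map3_snd_snd (φ : Word m → Word m) (t : Tr3 m) : (map3 φ t).2.2 = φ t.2.2 := rfl

/-- `map3 φ` undoes `map3 φ⁻¹`. -/
theorem map3_symm_apply (φ : Word m ≃ Word m) (t : Tr3 m) : map3 φ (map3 φ.symm t) = t := by
  simp [map3]

/-- **TRANSPORT.**  A word bijection mapping `frame κ` into `frame κ'` carries perfect matchings of
co-finite complements along. -/
theorem isPMκ_transport {κ κ' : Fin m → Bool} (φ : Word m ≃ Word m)
    (hφ : ∀ t ∈ frame κ, map3 φ t ∈ frame κ') {P : Finset (Tr3 m)} {X Y Z : Finset (Word m)}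
    (h : isPMκ κ P X Y Z = true) :
    isPMκ κ' (P.image (map3 φ)) (X.image φ) (Y.image φ) (Z.image φ) = true := by
  obtain ⟨hsub, j₁, j₂, j₃, i₁, i₂, i₃⟩ := isPMκ_iff.1 h
  rw [isPMκ_iff]
  refine ⟨?_, ?_, ?_, ?_, ?_, ?_, ?_⟩
  · intro s hs
    rw [mem_image] at hs
    obtain ⟨t, ht, rfl⟩ := hs
    exact hφ t (hsub ht)
  · intro s hs s' hs' e
    simp only [coe_image, Set.mem_image, mem_coe] at hs hs'
    obtain ⟨t, ht, rfl⟩ := hs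
    obtain ⟨t', ht', rfl⟩ := hs'
    rw [j₁ ht ht' (φ.injective e)]
  · intro s hs s' hs' e
    simp only [coe_image, Set.mem_image, mem_coe] at hs hs'
    obtain ⟨t, ht, rfl⟩ := hs
    obtain ⟨t', ht', rfl⟩ := hs'
    rw [j₂ ht ht' (φ.injective e)]
  · intro s hs s' hs' e
    simp only [coe_image, Set.mem_image, mem_coe] at hs hs'
    obtain ⟨t, ht, rfl⟩ := hs
    obtain ⟨t', ht', rfl⟩ := hs'
    rw [j₃ ht ht' (φ.injective e)]
  · rw [image_image, show (fun t : Tr3 m => t.1) ∘ map3 φ = φ ∘ fun t : Tr3 m => t.1 from rfl,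
      ← image_image, i₁, image_sdiff _ _ φ.injective, image_univ_of_surjective φ.surjective]
  · rw [image_image, show (fun t : Tr3 m => t.2.1) ∘ map3 φ = φ ∘ fun t : Tr3 m => t.2.1 from rfl,
      ← image_image, i₂, image_sdiff _ _ φ.injective, image_univ_of_surjective φ.surjective]
  · rw [image_image, show (fun t : Tr3 m => t.2.2) ∘ map3 φ = φ ∘ fun t : Tr3 m => t.2.2 from rfl,
      ← image_image, i₃, image_sdiff _ _ φ.injective, image_univ_of_surjective φ.surjective]

/-- Existence-level transport for co-size-2 complements. -/
theorem exists_isPMκ_transport {κ κ' : Fin m → Bool} (φ : Word m ≃ Word m)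
    (hφ : ∀ t ∈ frame κ, map3 φ t ∈ frame κ') {x₁ x₂ y₁ y₂ z₁ z₂ : Word m}
    (h : ∃ P, isPMκ κ P {x₁, x₂} {y₁, y₂} {z₁, z₂} = true) :
    ∃ P, isPMκ κ' P {φ x₁, φ x₂} {φ y₁, φ y₂} {φ z₁, φ z₂} = true := by
  obtain ⟨P, hP⟩ := h
  refine ⟨P.image (map3 φ), ?_⟩
  have h' := isPMκ_transport φ hφ hP
  simpa only [image_insert, image_singleton] using h'

/-! ## §2 Coordinate permutations -/

/-- Permuting the coordinates of words by `σ`. [new] -/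
def permW (σ : Equiv.Perm (Fin m)) : Word m ≃ Word m where
  toFun w := fun i => w (σ i)
  invFun w := fun i => w (σ.symm i)
  left_inv w := funext fun i => by simp
  right_inv w := funext fun i => by simp

/-- Pointwise formula for `permW`. -/
@[simp] theorem permW_apply (σ : Equiv.Perm (Fin m)) (w : Word m) (i : Fin m) :
    permW σ w i = w (σ i) := rfl

/-- Pointwise formula for `(permW σ)⁻¹`. -/
@[simp] theorem permW_symm_apply (σ : Equiv.Perm (Fin m)) (w : Word m) (i : Fin m) :
    (permW σ).symm w i = w (σ.symm i) := rfl

/-- `permW σ` maps `frame κ` into `frame (κ ∘ σ)`. -/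
theorem map3_permW_mem {κ : Fin m → Bool} (σ : Equiv.Perm (Fin m)) {t : Tr3 m}
    (ht : t ∈ frame κ) : map3 (permW σ) t ∈ frame (κ ∘ σ) := by
  rw [mem_frame] at ht ⊢
  intro i
  exact ht (σ i)

/-- Existence for the basis `κ ∘ σ` from existence for `κ` (pull the words back, push the matching
forward). -/
theorem exists_isPMκ_perm {κ : Fin m → Bool} (σ : Equiv.Perm (Fin m))
    (hκ : ∀ x₁ x₂ y₁ y₂ z₁ z₂ : Word m, x₁ ≠ x₂ → y₁ ≠ y₂ → z₁ ≠ z₂ →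
      (∀ i, lawκ (κ i) (x₁ i) (x₂ i) (y₁ i) (y₂ i) (z₁ i) (z₂ i) = true) →
      ∃ P, isPMκ κ P {x₁, x₂} {y₁, y₂} {z₁, z₂} = true)
    (x₁ x₂ y₁ y₂ z₁ z₂ : Word m) (hx : x₁ ≠ x₂) (hy : y₁ ≠ y₂) (hz : z₁ ≠ z₂)
    (hlaw : ∀ i, lawκ ((κ ∘ σ) i) (x₁ i) (x₂ i) (y₁ i) (y₂ i) (z₁ i) (z₂ i) = true) :
    ∃ P, isPMκ (κ ∘ σ) P {x₁, x₂} {y₁, y₂} {z₁, z₂} = true := by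
  have hne : ∀ {u v : Word m}, u ≠ v → (permW σ).symm u ≠ (permW σ).symm v :=
    fun h e => h ((permW σ).symm.injective e)
  have h := hκ ((permW σ).symm x₁) ((permW σ).symm x₂) ((permW σ).symm y₁) ((permW σ).symm y₂)
    ((permW σ).symm z₁) ((permW σ).symm z₂) (hne hx) (hne hy) (hne hz) fun i => by
      simp only [permW_symm_apply]
      have h := hlaw (σ.symm i)
      simp only [Function.comp_apply, Equiv.apply_symm_apply] at h
      exact h
  have h' := exists_isPMκ_transport (κ' := κ ∘ σ) (permW σ) (fun t ht => map3_permW_mem σ ht) h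
  simpa only [Equiv.apply_symm_apply] using h'

/-! ## §3 Letter relabellings -/

/-- Relabelling the letters of words coordinatewise by bijections `τ i`. [new] -/
def relabW (τ : Fin m → Equiv.Perm (Fin 3)) : Word m ≃ Word m where
  toFun w := fun i => τ i (w i)
  invFun w := fun i => (τ i).symm (w i)
  left_inv w := funext fun i => by simp
  right_inv w := funext fun i => by simp

/-- Pointwise formula for `relabW`. -/
@[simp] theorem relabW_apply (τ : Fin m → Equiv.Perm (Fin 3)) (w : Word m) (i : Fin m) :
    relabW τ w i = τ i (w i) := rfl

/-- Pointwise formula for `(relabW τ)⁻¹`. -/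
@[simp] theorem relabW_symm_apply (τ : Fin m → Equiv.Perm (Fin 3)) (w : Word m) (i : Fin m) :
    (relabW τ).symm w i = (τ i).symm (w i) := rfl

/-- `relabW τ` maps `frame κ` into itself when every `τ i` preserves the slots of `κ i`. -/
theorem map3_relabW_mem {κ : Fin m → Bool} {τ : Fin m → Equiv.Perm (Fin 3)}
    (hτ : ∀ i (a b c : Fin 3), slotB (κ i) a b c = true → slotB (κ i) (τ i a) (τ i b) (τ i c) = true)
    {t : Tr3 m} (ht : t ∈ frame κ) : map3 (relabW τ) t ∈ frame κ := by
  rw [mem_frame] at ht ⊢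
  intro i
  exact hτ i _ _ _ (ht i)

/-! ## §4 Exchanging the `B`- and `C`-legs -/

/-- Every slot pattern is invariant under exchanging the second and third letters. -/
theorem slotB_swap23 : ∀ (b : Bool) (x y z : Fin 3), slotB b x z y = slotB b x y z := by decide

/-- Exchange the `B`- and `C`-legs of a triple. [new] -/
def swapYZ (t : Tr3 m) : Tr3 m := (t.1, t.2.2, t.2.1)

/-- A perfect matching of the complement of `(X, Y, Z)` with its `B`- and `C`-legs exchanged is a
perfect matching of the complement of `(X, Z, Y)`. -/
theorem isPMκ_swapYZ {κ : Fin m → Bool} {P : Finset (Tr3 m)} {X Y Z : Finset (Word m)}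
    (h : isPMκ κ P X Y Z = true) : isPMκ κ (P.image swapYZ) X Z Y = true := by
  obtain ⟨hsub, j₁, j₂, j₃, i₁, i₂, i₃⟩ := isPMκ_iff.1 h
  rw [isPMκ_iff]
  refine ⟨?_, ?_, ?_, ?_, ?_, ?_, ?_⟩
  · intro s hs
    rw [mem_image] at hs
    obtain ⟨t, ht, rfl⟩ := hs
    have hf := mem_frame.1 (hsub ht)
    rw [mem_frame]
    intro i
    rw [← hf i]
    exact slotB_swap23 _ _ _ _
  · intro s hs s' hs' e
    simp only [coe_image, Set.mem_image, mem_coe] at hs hs'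
    obtain ⟨t, ht, rfl⟩ := hs
    obtain ⟨t', ht', rfl⟩ := hs'
    rw [j₁ ht ht' e]
  · intro s hs s' hs' e
    simp only [coe_image, Set.mem_image, mem_coe] at hs hs'
    obtain ⟨t, ht, rfl⟩ := hs
    obtain ⟨t', ht', rfl⟩ := hs'
    rw [j₃ ht ht' e]
  · intro s hs s' hs' e
    simp only [coe_image, Set.mem_image, mem_coe] at hs hs'
    obtain ⟨t, ht, rfl⟩ := hs
    obtain ⟨t', ht', rfl⟩ := hs'
    rw [j₂ ht ht' e]
  · rw [image_image]; exact i₁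
  · rw [image_image]; exact i₃
  · rw [image_image]; exact i₂

/-- The two-basis letter law is invariant under exchanging the `y`- and `z`-pairs. -/
theorem lawκ_swap_yz : ∀ (q : Bool) (a b c d e f : Fin 3), lawκ q a b c d e f = true →
    lawκ q a b e f c d = true := by
  decide

/-- Existence for `(X, Y, Z)` from existence for `(X, Z, Y)`. -/
theorem exists_isPMκ_swapYZ {κ : Fin m → Bool} {X Y Z : Finset (Word m)}
    (h : ∃ P, isPMκ κ P X Z Y = true) : ∃ P, isPMκ κ P X Y Z = true := by
  obtain ⟨P, hP⟩ := h
  exact ⟨_, isPMκ_swapYZ hP⟩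

end Summit.MatrixMultiplication.MatrixMultiplication.Theorems.OutsiderSandwichToricCeilingPowTransport
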